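import Literature.Analysis.FluidPDE.AxisymOmegaEnergy
import Literature.Analysis.FluidPDE.AxisymWeights
import HarnessLib

/-!
# The source term of the `J`-equation: `|∫ J (ωʳ∂ᵣ + ωᶻ∂_z)(vʳ/r)| ≤ ∫ |v^θ| |∇J| |∇(vʳ/r)|`
# (Lei–Zhang 2017, §3, (3.2))

Analysis/FluidPDE proof file (theorems only; no definitions, no named facts), sequel of
`AxisymOmegaEnergy.lean`, on the discharge path of the named facts
`Literature.Analysis.FluidPDE.LeiZhang2017_logModulus_regularity`,
`…LeiZhang2017_smallSwirl_regularity` and `…Wei2016_logModulus_regularity`.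

Lei–Zhang (arXiv:1505.02628, §3, p. 8): "Next, we estimate that
`|∫ J(ωʳ∂ᵣ + ωᶻ∂_z)(vʳ/r) dx| = |∫ [∇×(v^θ e_θ)]·(J∇(vʳ/r)) dx| ≤ ‖∇J‖_{L²} ‖v^θ ∇(vʳ/r)‖_{L²}`."
The mechanism: `∫ J ⟪∇W, curl u⟫ = ∫ ⟪curl (J∇W), u⟫ = ∫ ⟪∇J × ∇W, u⟫` (the curl is symmetric,
`curl (J∇W) = ∇J × ∇W`), and for axisymmetric scalars `J, W` the gradients are poloidal
(`⟪∇J, Jx⟫ = 0 = ⟪∇W, Jx⟫`, `J = rotGen`), so `∇J × ∇W` is toroidal and only the swirl component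
`u^θ` of `u` is seen: `|⟪∇J × ∇W, u⟫| ≤ |u^θ| |∇J| |∇W|`.

* `integral_mul_fderiv_mul_fderiv_coord` — one integration by parts:
  `∫ J ∂ᵢW ∂ⱼu_k = −∫ (∂ⱼJ ∂ᵢW + J ∂ⱼ∂ᵢW) u_k` (whole space, `L²`/boundedness hypotheses);
* `integral_mul_fderiv_apply_curl_eq` — **`∫ J · DW[curl u] = ∫ ⟪u, ∇J × ∇W⟫`** in coordinates
  (six integrations by parts; the `J ∂²W` terms cancel by symmetry of mixed partials);
* `abs_triple_le_of_poloidal` — the pointwise bound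
  `r |⟪u, a × b⟫| ≤ |x₀u₁ − x₁u₀| |a| |b|` for vectors `a, b` with `x₀a₁ = x₁a₀`, `x₀b₁ = x₁b₀`
  (poloidal), i.e. `|⟪u, a × b⟫| ≤ |u^θ| |a| |b|` off the axis;
* `integral_mul_fderiv_apply_curl_le` — **(3.2) in Young form**: for axisymmetric `C²` scalars
  `J, W` and an axisymmetric `C¹` field `u`,
  `∫ J · DW[curl u] ≤ ½ ∫ |∇J|² + ½ ∫ (u^θ)² |∇W|²`, `(u^θ)² |∇W|² = Φ² ρ |∇W|²`-free form
  `(swirl u)²/ρ · |∇W|²` written as `angVelQuot`-free `(x₀u₁ − x₁u₀)² / (x₀² + x₁²)`.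

## Mathlib / tree search

Tree: `fderiv_apply_eq_sum_three`, `two_mul_integral_coord_mul_mul_fderiv` (pattern)
(`AxisymOmegaEnergy`), `fderiv_apply_coord_vec3`, `contDiff_apply_coord_vec3`,
`fderiv_fderiv_apply_comm_vec_scalar` (`HouLeiLiEstimate`), `IsAxisymmetricScalar.fderiv_rotGen`,
`rotGen_eq_sub_single` (`SwirlTransportProofs`). The tree's curl integrations by parts
(`integral_inner_curl_eq_integral_inner_curl`, `…_of_decay`) assume compact support or pointwise
decay; here only `L²` membership and boundedness are available (Tao's class).
Mathlib: `integral_mul_fderiv_eq_neg_fderiv_mul_of_integrable`, `MemLp.integrable_mul`,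
`Integrable.bdd_mul`.

## References

* Z. Lei, Q. S. Zhang, Pacific J. Math. 289 (2017) 169–187, arXiv:1505.02628, §3 (3.2), p. 8.
  [`LeiZhang2017`]
* D. Wei, J. Math. Anal. Appl. 435 (2016) 402–413, arXiv:1508.03318, §3. [`Wei2016`]
-/

noncomputable section

open MeasureTheory Set Function Filter Topology InnerProductSpace WithLp
open scoped RealInnerProductSpace ContDiff ENNReal

namespace Literature.Analysis.FluidPDE

/-! ### One integration by parts -/

section IBP

variable {J W : EuclideanSpace ℝ (Fin 3) → ℝ} {u : EuclideanSpace ℝ (Fin 3) → EuclideanSpace ℝ (Fin 3)}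

/-- **`∫ J ∂ᵢW ∂ⱼu_k = −∫ (∂ⱼJ ∂ᵢW + J ∂ⱼ∂ᵢW) u_k`** on `ℝ³`, for `J ∈ C¹`, `W ∈ C²`, `u ∈ C¹` with
`J, ∂ᵢW, ∂ⱼJ, ∂ⱼ∂ᵢW ∈ L²` and `u`, `Du` bounded (whole-space integration by parts in the
direction `eⱼ`, `∂ⱼ(J ∂ᵢW) = ∂ⱼJ ∂ᵢW + J ∂ⱼ∂ᵢW`). [folklore] -/
theorem integral_mul_fderiv_mul_fderiv_coord (hJ : ContDiff ℝ 1 J) (hW : ContDiff ℝ 2 W)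
    (hu : ContDiff ℝ 1 u) (i j k : Fin 3) (hJ0 : MemLp J 2 volume)
    (hWi : MemLp (fun x => fderiv ℝ W x (EuclideanSpace.single i 1)) 2 volume)
    (hJj : MemLp (fun x => fderiv ℝ J x (EuclideanSpace.single j 1)) 2 volume)
    (hWji : MemLp (fun x => fderiv ℝ (fun y => fderiv ℝ W y (EuclideanSpace.single i 1)) x
      (EuclideanSpace.single j 1)) 2 volume)
    {B : ℝ} (huB : ∀ x, ‖u x‖ ≤ B) {B' : ℝ} (hDu : ∀ x, ‖fderiv ℝ u x‖ ≤ B') :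
    ∫ x, J x * fderiv ℝ W x (EuclideanSpace.single i 1) *
        fderiv ℝ u x (EuclideanSpace.single j 1) k =
      -∫ x, (fderiv ℝ J x (EuclideanSpace.single j 1) * fderiv ℝ W x (EuclideanSpace.single i 1) +
        J x * fderiv ℝ (fun y => fderiv ℝ W y (EuclideanSpace.single i 1)) x
          (EuclideanSpace.single j 1)) * u x k := by
  set ei : EuclideanSpace ℝ (Fin 3) := EuclideanSpace.single i 1 with hei
  set ej : EuclideanSpace ℝ (Fin 3) := EuclideanSpace.single j 1 with hej
  have hJd : Differentiable ℝ J := hJ.differentiable one_ne_zero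
  have hud : Differentiable ℝ u := hu.differentiable one_ne_zero
  have hWi1 : ContDiff ℝ 1 fun y => fderiv ℝ W y ei :=
    contDiff_fderiv_apply_const_succ (n := 1) (by exact_mod_cast hW) ei
  have hWid : Differentiable ℝ fun y => fderiv ℝ W y ei := hWi1.differentiable one_ne_zero
  have huk : ContDiff ℝ 1 fun x => u x k := contDiff_apply_coord_vec3 hu k
  have hukd : Differentiable ℝ fun x => u x k := huk.differentiable one_ne_zero
  have hF : Differentiable ℝ fun x => J x * fderiv ℝ W x ei := hJd.mul hWid
  -- derivatives
  have hDF : ∀ x, fderiv ℝ (fun y => J y * fderiv ℝ W y ei) x ej =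
      fderiv ℝ J x ej * fderiv ℝ W x ei + J x * fderiv ℝ (fun y => fderiv ℝ W y ei) x ej := by
    intro x
    rw [fderiv_fun_mul (hJd x) (hWid x)]
    simp only [_root_.add_apply, _root_.FunLike.coe_smul, Pi.smul_apply, smul_eq_mul]
    ring
  have hDg : ∀ x, fderiv ℝ (fun y => u y k) x ej = fderiv ℝ u x ej k := fun x =>
    fderiv_apply_coord_vec3 (hud x) k ej
  -- bounds and measurability of the bounded factors
  have hukB : ∀ x, ‖u x k‖ ≤ B := fun x => (PiLp.norm_apply_le (u x) k).trans (huB x)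
  have hDukB : ∀ x, ‖fderiv ℝ u x ej k‖ ≤ B' := fun x => by
    calc ‖fderiv ℝ u x ej k‖ ≤ ‖fderiv ℝ u x ej‖ := PiLp.norm_apply_le _ k
      _ ≤ ‖fderiv ℝ u x‖ * ‖ej‖ := (fderiv ℝ u x).le_opNorm ej
      _ = ‖fderiv ℝ u x‖ := by rw [hej]; simp
      _ ≤ B' := hDu x
  have hukm : AEStronglyMeasurable (fun x => u x k) volume := hukd.continuous.aestronglyMeasurable
  have hDuc : ContDiff ℝ 0 fun x => fderiv ℝ u x ej :=
    contDiff_zero.2 ((hu.continuous_fderiv one_ne_zero).clm_apply continuous_const)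
  have hDukm : AEStronglyMeasurable (fun x => fderiv ℝ u x ej k) volume :=
    (contDiff_apply_coord_vec3 hDuc k).continuous.aestronglyMeasurable
  -- integrable pieces
  have i1 : Integrable (fun x => J x * fderiv ℝ W x ei) volume := hJ0.integrable_mul hWi
  have i2 : Integrable (fun x => fderiv ℝ J x ej * fderiv ℝ W x ei) volume := hJj.integrable_mul hWi
  have i3 : Integrable (fun x => J x * fderiv ℝ (fun y => fderiv ℝ W y ei) x ej) volume :=
    hJ0.integrable_mul hWji
  have iA : Integrable (fun x => fderiv ℝ u x ej k * (J x * fderiv ℝ W x ei)) volume :=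
    i1.bdd_mul hDukm (ae_of_all _ hDukB)
  have iB : Integrable (fun x => u x k * (fderiv ℝ J x ej * fderiv ℝ W x ei +
      J x * fderiv ℝ (fun y => fderiv ℝ W y ei) x ej)) volume :=
    (i2.add i3).bdd_mul hukm (ae_of_all _ hukB)
  have iC : Integrable (fun x => u x k * (J x * fderiv ℝ W x ei)) volume :=
    i1.bdd_mul hukm (ae_of_all _ hukB)
  -- by parts
  have hibp := integral_mul_fderiv_eq_neg_fderiv_mul_of_integrable (μ := volume)
    (f := fun x => J x * fderiv ℝ W x ei) (g := fun x => u x k) (v := ej) ?_ ?_ ?_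
    (fun x _ => hF x) (fun x _ => hukd x)
  rotate_left
  · refine iB.congr (Eventually.of_forall fun x => ?_)
    beta_reduce; rw [hDF x]; ring
  · refine iA.congr (Eventually.of_forall fun x => ?_)
    beta_reduce; rw [hDg x]; ring
  · exact iC.congr (Eventually.of_forall fun x => by beta_reduce; ring)
  have hL : ∫ x, J x * fderiv ℝ W x ei * fderiv ℝ (fun y => u y k) x ej =
      ∫ x, J x * fderiv ℝ W x ei * fderiv ℝ u x ej k :=
    integral_congr_ae (Eventually.of_forall fun x => by beta_reduce; rw [hDg x])
  have hR : ∫ x, fderiv ℝ (fun y => J y * fderiv ℝ W y ei) x ej * u x k =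
      ∫ x, (fderiv ℝ J x ej * fderiv ℝ W x ei +
        J x * fderiv ℝ (fun y => fderiv ℝ W y ei) x ej) * u x k :=
    integral_congr_ae (Eventually.of_forall fun x => by beta_reduce; rw [hDF x])
  rw [hL, hR] at hibp
  exact hibp

end IBP

/-! ### `∫ J · DW[curl u] = ∫ ⟪u, ∇J × ∇W⟫` -/

section CurlPairing

variable {J W : EuclideanSpace ℝ (Fin 3) → ℝ} {u : EuclideanSpace ℝ (Fin 3) → EuclideanSpace ℝ (Fin 3)}

/-- **`∫ J · DW[curl u] = ∫ ⟪u, ∇J × ∇W⟫`** on `ℝ³` (the curl is symmetric and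
`curl (J∇W) = ∇J × ∇W`), in coordinates, for `J ∈ C¹`, `W ∈ C²`, `u ∈ C¹` with
`J, ∂ᵢW, ∂ⱼJ, ∂ⱼ∂ᵢW ∈ L²` and `u`, `Du` bounded. [cite: LeiZhang2017, §3 (3.2) (p. 8)] -/
theorem integral_mul_fderiv_apply_curl_eq (hJ : ContDiff ℝ 1 J) (hW : ContDiff ℝ 2 W)
    (hu : ContDiff ℝ 1 u) (hJ0 : MemLp J 2 volume)
    (hWi : ∀ i : Fin 3, MemLp (fun x => fderiv ℝ W x (EuclideanSpace.single i 1)) 2 volume)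
    (hJj : ∀ j : Fin 3, MemLp (fun x => fderiv ℝ J x (EuclideanSpace.single j 1)) 2 volume)
    (hWji : ∀ i j : Fin 3, MemLp (fun x => fderiv ℝ (fun y => fderiv ℝ W y (EuclideanSpace.single i 1)) x
      (EuclideanSpace.single j 1)) 2 volume)
    {B : ℝ} (huB : ∀ x, ‖u x‖ ≤ B) {B' : ℝ} (hDu : ∀ x, ‖fderiv ℝ u x‖ ≤ B') :
    ∫ x, J x * fderiv ℝ W x (curl u x) =
      ∫ x, (u x 0 * (fderiv ℝ J x (EuclideanSpace.single 1 1) * fderiv ℝ W x (EuclideanSpace.single 2 1) -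
              fderiv ℝ J x (EuclideanSpace.single 2 1) * fderiv ℝ W x (EuclideanSpace.single 1 1)) +
            u x 1 * (fderiv ℝ J x (EuclideanSpace.single 2 1) * fderiv ℝ W x (EuclideanSpace.single 0 1) -
              fderiv ℝ J x (EuclideanSpace.single 0 1) * fderiv ℝ W x (EuclideanSpace.single 2 1)) +
            u x 2 * (fderiv ℝ J x (EuclideanSpace.single 0 1) * fderiv ℝ W x (EuclideanSpace.single 1 1) -
              fderiv ℝ J x (EuclideanSpace.single 1 1) * fderiv ℝ W x (EuclideanSpace.single 0 1))) := by
  -- abbreviations for the partial derivatives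
  set e : Fin 3 → EuclideanSpace ℝ (Fin 3) := fun i => EuclideanSpace.single i 1 with he
  have he' : ∀ i, EuclideanSpace.single i (1 : ℝ) = e i := fun i => rfl
  simp only [he'] at hWi hJj hWji ⊢
  set dJ : Fin 3 → EuclideanSpace ℝ (Fin 3) → ℝ := fun j x => fderiv ℝ J x (e j) with hdJ
  set dW : Fin 3 → EuclideanSpace ℝ (Fin 3) → ℝ := fun i x => fderiv ℝ W x (e i) with hdW
  set ddW : Fin 3 → Fin 3 → EuclideanSpace ℝ (Fin 3) → ℝ := fun i j x =>
    fderiv ℝ (fun y => fderiv ℝ W y (e i)) x (e j) with hddW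
  set du : Fin 3 → Fin 3 → EuclideanSpace ℝ (Fin 3) → ℝ := fun j k x => fderiv ℝ u x (e j) k with hdu
  have hud : Differentiable ℝ u := hu.differentiable one_ne_zero
  -- the unit identity, for all index triples
  have hU : ∀ i j k : Fin 3, ∫ x, J x * dW i x * du j k x =
      -∫ x, (dJ j x * dW i x + J x * ddW i j x) * u x k := fun i j k =>
    integral_mul_fderiv_mul_fderiv_coord hJ hW hu i j k hJ0 (hWi i) (hJj j) (hWji i j) huB hDu
  -- symmetry of the mixed partials of `W`
  have hsymm : ∀ i j x, ddW i j x = ddW j i x := fun i j x =>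
    fderiv_fderiv_apply_comm_vec_scalar hW x (e i) (e j)
  -- integrability of the pieces
  have hukB : ∀ (k : Fin 3) x, ‖u x k‖ ≤ B := fun k x => (PiLp.norm_apply_le (u x) k).trans (huB x)
  have hDukB : ∀ (j k : Fin 3) x, ‖du j k x‖ ≤ B' := fun j k x => by
    calc ‖fderiv ℝ u x (e j) k‖ ≤ ‖fderiv ℝ u x (e j)‖ := PiLp.norm_apply_le _ k
      _ ≤ ‖fderiv ℝ u x‖ * ‖e j‖ := (fderiv ℝ u x).le_opNorm (e j)
      _ = ‖fderiv ℝ u x‖ := by simp [he]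
      _ ≤ B' := hDu x
  have hukm : ∀ k : Fin 3, AEStronglyMeasurable (fun x => u x k) volume := fun k =>
    (contDiff_apply_coord_vec3 hu k).continuous.aestronglyMeasurable
  have hDuc : ∀ j : Fin 3, ContDiff ℝ 0 fun x => fderiv ℝ u x (e j) := fun j =>
    contDiff_zero.2 ((hu.continuous_fderiv one_ne_zero).clm_apply continuous_const)
  have hDukm : ∀ j k : Fin 3, AEStronglyMeasurable (du j k) volume := fun j k =>
    (contDiff_apply_coord_vec3 (hDuc j) k).continuous.aestronglyMeasurable
  have iL : ∀ i j k : Fin 3, Integrable (fun x => J x * dW i x * du j k x) volume := by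
    intro i j k
    have h0 : Integrable (fun x => J x * dW i x) volume := hJ0.integrable_mul (hWi i)
    have h := h0.bdd_mul (hDukm j k) (ae_of_all _ (hDukB j k))
    exact h.congr (Eventually.of_forall fun x => by beta_reduce; ring)
  have iR : ∀ i j k : Fin 3, Integrable (fun x => (dJ j x * dW i x + J x * ddW i j x) * u x k) volume := by
    intro i j k
    have h1 : Integrable (fun x => dJ j x * dW i x) volume := (hJj j).integrable_mul (hWi i)
    have h2 : Integrable (fun x => J x * ddW i j x) volume := hJ0.integrable_mul (hWji i j)
    have h12 : Integrable (fun x => dJ j x * dW i x + J x * ddW i j x) volume := h1.add h2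
    have h := h12.bdd_mul (hukm k) (ae_of_all _ (hukB k))
    exact h.congr (Eventually.of_forall fun x => by beta_reduce; ring)
  -- the left-hand side in coordinates
  have hcurl : ∀ x, J x * fderiv ℝ W x (curl u x) =
      J x * dW 0 x * du 1 2 x - J x * dW 0 x * du 2 1 x +
      (J x * dW 1 x * du 2 0 x - J x * dW 1 x * du 0 2 x) +
      (J x * dW 2 x * du 0 1 x - J x * dW 2 x * du 1 0 x) := by
    intro x
    rw [fderiv_apply_eq_sum_three W x (curl u x)]
    simp only [hdW, hdu, he, FluidPDE.curl]
    simp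
    ring
  have hLHS : ∫ x, J x * fderiv ℝ W x (curl u x) =
      ((∫ x, J x * dW 0 x * du 1 2 x) - ∫ x, J x * dW 0 x * du 2 1 x) +
      ((∫ x, J x * dW 1 x * du 2 0 x) - ∫ x, J x * dW 1 x * du 0 2 x) +
      ((∫ x, J x * dW 2 x * du 0 1 x) - ∫ x, J x * dW 2 x * du 1 0 x) := by
    have i01 : Integrable (fun x => J x * dW 0 x * du 1 2 x - J x * dW 0 x * du 2 1 x) volume :=
      (iL 0 1 2).sub (iL 0 2 1)
    have i12 : Integrable (fun x => J x * dW 1 x * du 2 0 x - J x * dW 1 x * du 0 2 x) volume :=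
      (iL 1 2 0).sub (iL 1 0 2)
    have i20 : Integrable (fun x => J x * dW 2 x * du 0 1 x - J x * dW 2 x * du 1 0 x) volume :=
      (iL 2 0 1).sub (iL 2 1 0)
    have iS : Integrable (fun x => J x * dW 0 x * du 1 2 x - J x * dW 0 x * du 2 1 x +
        (J x * dW 1 x * du 2 0 x - J x * dW 1 x * du 0 2 x)) volume := i01.add i12
    rw [integral_congr_ae (Eventually.of_forall hcurl), integral_add iS i20, integral_add i01 i12,
      integral_sub (iL 0 1 2) (iL 0 2 1), integral_sub (iL 1 2 0) (iL 1 0 2),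
      integral_sub (iL 2 0 1) (iL 2 1 0)]
  -- the right-hand side in coordinates
  have hRHS : ∫ x, (u x 0 * (dJ 1 x * dW 2 x - dJ 2 x * dW 1 x) +
        u x 1 * (dJ 2 x * dW 0 x - dJ 0 x * dW 2 x) +
        u x 2 * (dJ 0 x * dW 1 x - dJ 1 x * dW 0 x)) =
      (-(∫ x, (dJ 1 x * dW 0 x + J x * ddW 0 1 x) * u x 2) +
          ∫ x, (dJ 2 x * dW 0 x + J x * ddW 0 2 x) * u x 1) +
      (-(∫ x, (dJ 2 x * dW 1 x + J x * ddW 1 2 x) * u x 0) +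
          ∫ x, (dJ 0 x * dW 1 x + J x * ddW 1 0 x) * u x 2) +
      (-(∫ x, (dJ 0 x * dW 2 x + J x * ddW 2 0 x) * u x 1) +
          ∫ x, (dJ 1 x * dW 2 x + J x * ddW 2 1 x) * u x 0) := by
    have i01 : Integrable (fun x => -((dJ 1 x * dW 0 x + J x * ddW 0 1 x) * u x 2) +
        (dJ 2 x * dW 0 x + J x * ddW 0 2 x) * u x 1) volume := (iR 0 1 2).neg.add (iR 0 2 1)
    have i12 : Integrable (fun x => -((dJ 2 x * dW 1 x + J x * ddW 1 2 x) * u x 0) +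
        (dJ 0 x * dW 1 x + J x * ddW 1 0 x) * u x 2) volume := (iR 1 2 0).neg.add (iR 1 0 2)
    have i20 : Integrable (fun x => -((dJ 0 x * dW 2 x + J x * ddW 2 0 x) * u x 1) +
        (dJ 1 x * dW 2 x + J x * ddW 2 1 x) * u x 0) volume := (iR 2 0 1).neg.add (iR 2 1 0)
    have iS : Integrable (fun x => -((dJ 1 x * dW 0 x + J x * ddW 0 1 x) * u x 2) +
        (dJ 2 x * dW 0 x + J x * ddW 0 2 x) * u x 1 +
        (-((dJ 2 x * dW 1 x + J x * ddW 1 2 x) * u x 0) +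
        (dJ 0 x * dW 1 x + J x * ddW 1 0 x) * u x 2)) volume := i01.add i12
    have hn01 : Integrable (fun x => -((dJ 1 x * dW 0 x + J x * ddW 0 1 x) * u x 2)) volume :=
      (iR 0 1 2).neg
    have hn12 : Integrable (fun x => -((dJ 2 x * dW 1 x + J x * ddW 1 2 x) * u x 0)) volume :=
      (iR 1 2 0).neg
    have hn20 : Integrable (fun x => -((dJ 0 x * dW 2 x + J x * ddW 2 0 x) * u x 1)) volume :=
      (iR 2 0 1).neg
    rw [← integral_neg, ← integral_neg, ← integral_neg, ← integral_add hn01 (iR 0 2 1),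
      ← integral_add hn12 (iR 1 0 2), ← integral_add hn20 (iR 2 1 0), ← integral_add i01 i12,
      ← integral_add iS i20]
    refine integral_congr_ae (Eventually.of_forall fun x => ?_)
    have h01 := hsymm 0 1 x
    have h02 := hsymm 0 2 x
    have h12 := hsymm 1 2 x
    linear_combination (u x 2 * J x) * h01 - (u x 1 * J x) * h02 + (u x 0 * J x) * h12
  rw [hLHS, hRHS, hU 0 1 2, hU 0 2 1, hU 1 2 0, hU 1 0 2, hU 2 0 1, hU 2 1 0]
  ring

end CurlPairing

/-! ### The pointwise bound for poloidal vectors -/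

section Pointwise
set_option maxHeartbeats 400000 in -- buildfix (bf3-g27): 160k/180k FAIL, 200k PASS at accept time; line-neutral budget line
/-- **Toroidal cross products see only the swirl**: for real numbers with `x₀a₁ = x₁a₀` and
`x₀b₁ = x₁b₀` (the horizontal parts of `a`, `b` parallel to `x_h`),
`√(x₀² + x₁²) · |⟪u, a × b⟫| ≤ |x₀u₁ − x₁u₀| · |a| · |b|`. Proof: with `pa = ⟪x_h, a_h⟫`,
`pb = ⟪x_h, b_h⟫`, `ρ = x₀² + x₁²`, one has `ρ ⟪u, a × b⟫ = (x₀u₁ − x₁u₀)(pb a₂ − pa b₂)` and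
`|pb a₂ − pa b₂| ≤ √ρ (|b_h||a₂| + |a_h||b₂|) ≤ √ρ |a| |b|`. [folklore] -/
theorem abs_triple_le_of_poloidal (x₀ x₁ a₀ a₁ a₂ b₀ b₁ b₂ u₀ u₁ u₂ : ℝ)
    (ha : x₀ * a₁ = x₁ * a₀) (hb : x₀ * b₁ = x₁ * b₀) :
    Real.sqrt (x₀ ^ 2 + x₁ ^ 2) *
        |u₀ * (a₁ * b₂ - a₂ * b₁) + u₁ * (a₂ * b₀ - a₀ * b₂) + u₂ * (a₀ * b₁ - a₁ * b₀)| ≤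
      |x₀ * u₁ - x₁ * u₀| * Real.sqrt (a₀ ^ 2 + a₁ ^ 2 + a₂ ^ 2) *
        Real.sqrt (b₀ ^ 2 + b₁ ^ 2 + b₂ ^ 2) := by
  -- names
  set ρ := x₀ ^ 2 + x₁ ^ 2 with hρ
  set τ := u₀ * (a₁ * b₂ - a₂ * b₁) + u₁ * (a₂ * b₀ - a₀ * b₂) + u₂ * (a₀ * b₁ - a₁ * b₀) with hτ
  set σ := x₀ * u₁ - x₁ * u₀ with hσ
  set pa := x₀ * a₀ + x₁ * a₁ with hpa
  set pb := x₀ * b₀ + x₁ * b₁ with hpb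
  set α := Real.sqrt (a₀ ^ 2 + a₁ ^ 2) with hα
  set β := Real.sqrt (b₀ ^ 2 + b₁ ^ 2) with hβ
  set s := Real.sqrt ρ with hs
  have hρ0 : 0 ≤ ρ := by positivity
  have hα0 : 0 ≤ α := Real.sqrt_nonneg _
  have hβ0 : 0 ≤ β := Real.sqrt_nonneg _
  have hs0 : 0 ≤ s := Real.sqrt_nonneg _
  have hα2 : α ^ 2 = a₀ ^ 2 + a₁ ^ 2 := Real.sq_sqrt (by positivity)
  have hβ2 : β ^ 2 = b₀ ^ 2 + b₁ ^ 2 := Real.sq_sqrt (by positivity)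
  have hs2 : s ^ 2 = ρ := Real.sq_sqrt hρ0
  -- the key algebraic identity `ρ τ = σ (pb a₂ − pa b₂)`
  have hkey : ρ * τ = σ * (pb * a₂ - pa * b₂) := by
    simp only [hρ, hτ, hσ, hpa, hpb]
    linear_combination (u₀ * x₀ * b₂ + u₁ * x₁ * b₂ - u₂ * (x₀ * b₀ + x₁ * b₁)) * ha +
      (u₂ * (x₀ * a₀ + x₁ * a₁) - u₀ * x₀ * a₂ - u₁ * x₁ * a₂) * hb
  -- `|pa| ≤ s α`, `|pb| ≤ s β` (Cauchy–Schwarz in the plane)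
  have hpa' : |pa| ≤ s * α := by
    refine abs_le_of_sq_le_sq ?_ (mul_nonneg hs0 hα0)
    rw [mul_pow, hs2, hα2]
    simp only [hpa, hρ]
    nlinarith [sq_nonneg (x₀ * a₁ - x₁ * a₀)]
  have hpb' : |pb| ≤ s * β := by
    refine abs_le_of_sq_le_sq ?_ (mul_nonneg hs0 hβ0)
    rw [mul_pow, hs2, hβ2]
    simp only [hpb, hρ]
    nlinarith [sq_nonneg (x₀ * b₁ - x₁ * b₀)]
  -- `|pb a₂ − pa b₂| ≤ s (β |a₂| + α |b₂|)`
  have hmid : |pb * a₂ - pa * b₂| ≤ s * (β * |a₂| + α * |b₂|) := by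
    calc |pb * a₂ - pa * b₂| ≤ |pb * a₂| + |pa * b₂| := abs_sub _ _
      _ = |pb| * |a₂| + |pa| * |b₂| := by rw [abs_mul, abs_mul]
      _ ≤ s * β * |a₂| + s * α * |b₂| := by gcongr
      _ = s * (β * |a₂| + α * |b₂|) := by ring
  -- `β |a₂| + α |b₂| ≤ √(α² + a₂²) √(β² + b₂²)` (Cauchy–Schwarz)
  have hA : Real.sqrt (a₀ ^ 2 + a₁ ^ 2 + a₂ ^ 2) = Real.sqrt (α ^ 2 + |a₂| ^ 2) := by
    rw [hα2, sq_abs]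
  have hB : Real.sqrt (b₀ ^ 2 + b₁ ^ 2 + b₂ ^ 2) = Real.sqrt (β ^ 2 + |b₂| ^ 2) := by
    rw [hβ2, sq_abs]
  have hcs : β * |a₂| + α * |b₂| ≤ Real.sqrt (α ^ 2 + |a₂| ^ 2) * Real.sqrt (β ^ 2 + |b₂| ^ 2) := by
    rw [← Real.sqrt_mul (by positivity)]
    refine Real.le_sqrt_of_sq_le ?_
    nlinarith [sq_nonneg (α * β - |a₂| * |b₂|), abs_nonneg a₂, abs_nonneg b₂,
      mul_nonneg hα0 hβ0, mul_nonneg (abs_nonneg a₂) (abs_nonneg b₂)]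
  -- assemble
  rcases eq_or_lt_of_le hρ0 with h0 | hpos
  · have hs' : s = 0 := by
      have hρz : ρ = 0 := h0.symm
      rw [hs, hρz, Real.sqrt_zero]
    rw [hs', zero_mul]
    positivity
  · have hs_pos : 0 < s := Real.sqrt_pos.2 hpos
    have h3 : s * (s * |τ|) ≤
        s * (|σ| * Real.sqrt (α ^ 2 + |a₂| ^ 2) * Real.sqrt (β ^ 2 + |b₂| ^ 2)) := by
      calc s * (s * |τ|) = |ρ * τ| := by
            rw [abs_mul, abs_of_nonneg hρ0, ← hs2]; ring
        _ = |σ| * |pb * a₂ - pa * b₂| := by rw [hkey, abs_mul]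
        _ ≤ |σ| * (s * (β * |a₂| + α * |b₂|)) := by gcongr
        _ ≤ |σ| * (s * (Real.sqrt (α ^ 2 + |a₂| ^ 2) * Real.sqrt (β ^ 2 + |b₂| ^ 2))) := by gcongr
        _ = s * (|σ| * Real.sqrt (α ^ 2 + |a₂| ^ 2) * Real.sqrt (β ^ 2 + |b₂| ^ 2)) := by ring
    rw [hA, hB]
    exact le_of_mul_le_mul_left h3 hs_pos

end Pointwise

/-! ### The estimate (3.2) -/

section Estimate

variable {J W : EuclideanSpace ℝ (Fin 3) → ℝ} {u : EuclideanSpace ℝ (Fin 3) → EuclideanSpace ℝ (Fin 3)}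

/-- **Lei–Zhang (3.2) in Young form**: for axisymmetric scalars `J, W ∈ C²` and a `C¹` field `u`
with `J, ∂ᵢW, ∂ⱼJ, ∂ⱼ∂ᵢW ∈ L²` and `u`, `Du` bounded,
`∫ J · DW[curl u] ≤ ½ ∫ |∇J|² + ½ ∫ (u^θ)² |∇W|²`, where `(u^θ)² = (x₀u₁ − x₁u₀)²/(x₀² + x₁²)`
(a.e.; the axis is null). With `u` the velocity, `W = vʳ/r`, `J = ωʳ/r` this is
"`|∫ J(ωʳ∂ᵣ + ωᶻ∂_z)(vʳ/r)| ≤ ‖∇J‖ ‖v^θ∇(vʳ/r)‖ ≤ ½‖∇J‖² + ½‖v^θ∇(vʳ/r)‖²`".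
[cite: LeiZhang2017, §3 (3.2) (p. 8)] -/
theorem integral_mul_fderiv_apply_curl_le (hJ : ContDiff ℝ 2 J) (hW : ContDiff ℝ 2 W)
    (hu : ContDiff ℝ 1 u) (hJax : IsAxisymmetricScalar J) (hWax : IsAxisymmetricScalar W)
    (hJ0 : MemLp J 2 volume)
    (hWi : ∀ i : Fin 3, MemLp (fun x => fderiv ℝ W x (EuclideanSpace.single i 1)) 2 volume)
    (hJj : ∀ j : Fin 3, MemLp (fun x => fderiv ℝ J x (EuclideanSpace.single j 1)) 2 volume)
    (hWji : ∀ i j : Fin 3, MemLp (fun x => fderiv ℝ (fun y => fderiv ℝ W y (EuclideanSpace.single i 1)) x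
      (EuclideanSpace.single j 1)) 2 volume)
    {B : ℝ} (huB : ∀ x, ‖u x‖ ≤ B) {B' : ℝ} (hDu : ∀ x, ‖fderiv ℝ u x‖ ≤ B') :
    ∫ x, J x * fderiv ℝ W x (curl u x) ≤
      (1 / 2) * (∫ x, (fderiv ℝ J x (EuclideanSpace.single 0 1) ^ 2 +
          fderiv ℝ J x (EuclideanSpace.single 1 1) ^ 2 + fderiv ℝ J x (EuclideanSpace.single 2 1) ^ 2)) +
      (1 / 2) * ∫ x, (swirl u x) ^ 2 / (x 0 ^ 2 + x 1 ^ 2) *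
          (fderiv ℝ W x (EuclideanSpace.single 0 1) ^ 2 + fderiv ℝ W x (EuclideanSpace.single 1 1) ^ 2 +
            fderiv ℝ W x (EuclideanSpace.single 2 1) ^ 2) := by
  have hJ1 : ContDiff ℝ 1 J := hJ.of_le (by norm_num)
  have hJd : Differentiable ℝ J := hJ1.differentiable one_ne_zero
  have hWd : Differentiable ℝ W := hW.differentiable two_ne_zero
  rw [integral_mul_fderiv_apply_curl_eq hJ1 hW hu hJ0 hWi hJj hWji huB hDu]
  -- abbreviations
  set e : Fin 3 → EuclideanSpace ℝ (Fin 3) := fun i => EuclideanSpace.single i 1 with he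
  have he' : ∀ i, EuclideanSpace.single i (1 : ℝ) = e i := fun i => rfl
  simp only [he'] at hWi hJj ⊢
  set A : EuclideanSpace ℝ (Fin 3) → ℝ := fun x =>
    fderiv ℝ J x (e 0) ^ 2 + fderiv ℝ J x (e 1) ^ 2 + fderiv ℝ J x (e 2) ^ 2 with hA
  set Bw : EuclideanSpace ℝ (Fin 3) → ℝ := fun x =>
    fderiv ℝ W x (e 0) ^ 2 + fderiv ℝ W x (e 1) ^ 2 + fderiv ℝ W x (e 2) ^ 2 with hBw
  set wgt : EuclideanSpace ℝ (Fin 3) → ℝ := fun x => (swirl u x) ^ 2 / (x 0 ^ 2 + x 1 ^ 2) with hwgt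
  set τ : EuclideanSpace ℝ (Fin 3) → ℝ := fun x =>
    u x 0 * (fderiv ℝ J x (e 1) * fderiv ℝ W x (e 2) - fderiv ℝ J x (e 2) * fderiv ℝ W x (e 1)) +
    u x 1 * (fderiv ℝ J x (e 2) * fderiv ℝ W x (e 0) - fderiv ℝ J x (e 0) * fderiv ℝ W x (e 2)) +
    u x 2 * (fderiv ℝ J x (e 0) * fderiv ℝ W x (e 1) - fderiv ℝ J x (e 1) * fderiv ℝ W x (e 0)) with hτ
  change ∫ x, τ x ≤ (1 / 2) * (∫ x, A x) + (1 / 2) * ∫ x, wgt x * Bw x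
  -- the weight is bounded: `0 ≤ wgt ≤ B²`
  have hB0 : 0 ≤ B := (norm_nonneg _).trans (huB 0)
  have hwgt0 : ∀ x, 0 ≤ wgt x := fun x => by simp only [hwgt]; positivity
  have hwgtB : ∀ x, wgt x ≤ B ^ 2 := by
    intro x
    simp only [hwgt]
    rcases eq_or_lt_of_le (show (0 : ℝ) ≤ x 0 ^ 2 + x 1 ^ 2 by positivity) with h0 | hpos
    · rw [← h0, div_zero]; positivity
    · rw [div_le_iff₀ hpos]
      have h1 : (swirl u x) ^ 2 ≤ (x 0 ^ 2 + x 1 ^ 2) * (u x 0 ^ 2 + u x 1 ^ 2) := by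
        simp only [swirl]
        nlinarith [sq_nonneg (x 0 * u x 0 + x 1 * u x 1)]
      have h2 : u x 0 ^ 2 + u x 1 ^ 2 ≤ B ^ 2 := by
        have hn : ‖u x‖ ^ 2 = u x 0 ^ 2 + u x 1 ^ 2 + u x 2 ^ 2 := by
          rw [EuclideanSpace.norm_eq, Real.sq_sqrt (by positivity), Fin.sum_univ_three]
          simp only [Real.norm_eq_abs, sq_abs]
        nlinarith [pow_le_pow_left₀ (norm_nonneg _) (huB x) 2, sq_nonneg (u x 2)]
      nlinarith [h1, h2]
  -- integrability
  have iA : Integrable A volume := by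
    have h := ((hJj 0).integrable_sq.add (hJj 1).integrable_sq).add (hJj 2).integrable_sq
    exact h.congr (Eventually.of_forall fun x => by simp only [hA, Pi.add_apply])
  have iBw : Integrable Bw volume := by
    have h := ((hWi 0).integrable_sq.add (hWi 1).integrable_sq).add (hWi 2).integrable_sq
    exact h.congr (Eventually.of_forall fun x => by simp only [hBw, Pi.add_apply])
  have hwgtm : AEStronglyMeasurable wgt volume := by
    have h1 : Continuous fun x : EuclideanSpace ℝ (Fin 3) => (swirl u x) ^ 2 :=
      ((contDiff_swirl hu).continuous).pow 2
    have h2 : Continuous fun x : EuclideanSpace ℝ (Fin 3) => x 0 ^ 2 + x 1 ^ 2 := by fun_prop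
    exact (h1.measurable.div h2.measurable).aestronglyMeasurable
  have iwB : Integrable (fun x => wgt x * Bw x) volume := by
    refine (iBw.const_mul (B ^ 2)).mono' (hwgtm.mul iBw.aestronglyMeasurable)
      (Eventually.of_forall fun x => ?_)
    have hBw0 : 0 ≤ Bw x := by simp only [hBw]; positivity
    rw [Real.norm_eq_abs, abs_of_nonneg (mul_nonneg (hwgt0 x) hBw0)]
    exact mul_le_mul_of_nonneg_right (hwgtB x) hBw0
  -- the pointwise bound off the axis
  have hae : ∀ᵐ x ∂(volume : Measure (EuclideanSpace ℝ (Fin 3))), x 0 ^ 2 + x 1 ^ 2 ≠ 0 := by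
    rw [ae_iff]
    simp only [ne_eq, not_not]
    exact volume_axis_eq_zero
  have hpt : ∀ᵐ x ∂(volume : Measure (EuclideanSpace ℝ (Fin 3))),
      τ x ≤ (1 / 2) * A x + (1 / 2) * (wgt x * Bw x) := by
    filter_upwards [hae] with x hx
    have hpos : 0 < x 0 ^ 2 + x 1 ^ 2 := lt_of_le_of_ne (by positivity) (Ne.symm hx)
    -- poloidality of `∇J`, `∇W`
    have hpa : x 0 * fderiv ℝ J x (e 1) = x 1 * fderiv ℝ J x (e 0) := by
      have h := hJax.fderiv_rotGen (hJd x)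
      rw [rotGen_eq_sub_single, map_sub, map_smul, map_smul, smul_eq_mul, smul_eq_mul] at h
      simp only [he]
      linarith
    have hpb : x 0 * fderiv ℝ W x (e 1) = x 1 * fderiv ℝ W x (e 0) := by
      have h := hWax.fderiv_rotGen (hWd x)
      rw [rotGen_eq_sub_single, map_sub, map_smul, map_smul, smul_eq_mul, smul_eq_mul] at h
      simp only [he]
      linarith
    have hkey := abs_triple_le_of_poloidal (x 0) (x 1) (fderiv ℝ J x (e 0)) (fderiv ℝ J x (e 1))
      (fderiv ℝ J x (e 2)) (fderiv ℝ W x (e 0)) (fderiv ℝ W x (e 1)) (fderiv ℝ W x (e 2))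
      (u x 0) (u x 1) (u x 2) hpa hpb
    -- `hkey : √ρ |τ x| ≤ |σ| √A √Bw`
    have hτx : τ x = u x 0 * (fderiv ℝ J x (e 1) * fderiv ℝ W x (e 2) -
        fderiv ℝ J x (e 2) * fderiv ℝ W x (e 1)) +
        u x 1 * (fderiv ℝ J x (e 2) * fderiv ℝ W x (e 0) - fderiv ℝ J x (e 0) * fderiv ℝ W x (e 2)) +
        u x 2 * (fderiv ℝ J x (e 0) * fderiv ℝ W x (e 1) - fderiv ℝ J x (e 1) * fderiv ℝ W x (e 0)) := rfl
    have hswirl : swirl u x = x 0 * u x 1 - x 1 * u x 0 := rfl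
    set s := Real.sqrt (x 0 ^ 2 + x 1 ^ 2) with hs
    have hs_pos : 0 < s := Real.sqrt_pos.2 hpos
    have hs2 : s ^ 2 = x 0 ^ 2 + x 1 ^ 2 := Real.sq_sqrt hpos.le
    set X := Real.sqrt (A x) with hX
    set Y := |swirl u x| / s * Real.sqrt (Bw x) with hY
    have hAx0 : 0 ≤ A x := by simp only [hA]; positivity
    have hBx0 : 0 ≤ Bw x := by simp only [hBw]; positivity
    have hX2 : X ^ 2 = A x := Real.sq_sqrt hAx0
    have hY2 : Y ^ 2 = wgt x * Bw x := by
      simp only [hY, hwgt]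
      rw [mul_pow, div_pow, sq_abs, Real.sq_sqrt hBx0, hs2]
    have h1 : |τ x| ≤ X * Y := by
      have hk : s * |τ x| ≤ |swirl u x| * Real.sqrt (A x) * Real.sqrt (Bw x) := by
        rw [hτx, hswirl]; exact hkey
      rw [hX, hY]
      rw [show Real.sqrt (A x) * (|swirl u x| / s * Real.sqrt (Bw x)) =
        (|swirl u x| * Real.sqrt (A x) * Real.sqrt (Bw x)) / s by ring]
      rw [le_div_iff₀ hs_pos, mul_comm]
      exact hk
    have h2 : X * Y ≤ (1 / 2) * A x + (1 / 2) * (wgt x * Bw x) := by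
      rw [← hX2, ← hY2]
      nlinarith [sq_nonneg (X - Y)]
    exact (le_abs_self _).trans (h1.trans h2)
  -- integrate
  calc ∫ x, τ x ≤ ∫ x, ((1 / 2) * A x + (1 / 2) * (wgt x * Bw x)) :=
        integral_mono_ae ?_ ((iA.const_mul _).add (iwB.const_mul _)) hpt
    _ = (1 / 2) * (∫ x, A x) + (1 / 2) * ∫ x, wgt x * Bw x := by
        rw [integral_add (iA.const_mul _) (iwB.const_mul _), integral_const_mul, integral_const_mul]
  -- integrability of `τ` (bounded `u` times products of `L²` derivatives)
  have hukB : ∀ (k : Fin 3) x, ‖u x k‖ ≤ B := fun k x => (PiLp.norm_apply_le (u x) k).trans (huB x)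
  have hukm : ∀ k : Fin 3, AEStronglyMeasurable (fun x => u x k) volume := fun k =>
    (contDiff_apply_coord_vec3 hu k).continuous.aestronglyMeasurable
  have iP : ∀ (k i j : Fin 3), Integrable (fun x => u x k * (fderiv ℝ J x (e i) * fderiv ℝ W x (e j)))
      volume := fun k i j => ((hJj i).integrable_mul (hWi j)).bdd_mul (hukm k) (ae_of_all _ (hukB k))
  have iτ' : Integrable (fun x =>
      (u x 0 * (fderiv ℝ J x (e 1) * fderiv ℝ W x (e 2)) - u x 0 * (fderiv ℝ J x (e 2) * fderiv ℝ W x (e 1))) +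
      (u x 1 * (fderiv ℝ J x (e 2) * fderiv ℝ W x (e 0)) - u x 1 * (fderiv ℝ J x (e 0) * fderiv ℝ W x (e 2))) +
      (u x 2 * (fderiv ℝ J x (e 0) * fderiv ℝ W x (e 1)) - u x 2 * (fderiv ℝ J x (e 1) * fderiv ℝ W x (e 0))))
      volume :=
    (((iP 0 1 2).sub (iP 0 2 1)).add ((iP 1 2 0).sub (iP 1 0 2))).add ((iP 2 0 1).sub (iP 2 1 0))
  exact iτ'.congr (Eventually.of_forall fun x => by simp only [hτ]; ring)

end Estimate

end Literature.Analysis.FluidPDE
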